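import Summits.ABC.ABC.Theses.IsogenyGlueCongruence

/-!
# `TorsionSharingPrimeBound` (stmt-ABC-2157, route ABC/IsogenyGlueCongruence) — negative-side lemmas II:
# algebraic-integer congruences, the "new" conjunct, and the eigenvalue form of rigidity

Standing-adversary (cdisprove) output for the crux
`K = Summit.ABC.ABC.Theses.IsogenyGlueCongruence.TorsionSharingPrimeBound`, companion of
`TorsionSharingPrimeBoundLoadBearing.lean` (independent of it). Proved here, sorry-free:

* `exists_ringHom_algInt_charP` — for every prime `ℓ` the ring `algInt` of ALL algebraic integers of
  `ℂ` maps onto a field of characteristic `ℓ` (a maximal ideal above `ℓ`, lying over). Consequently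
  the `(R, F, φ)` congruence hypothesis of K is met by ANY `g` with algebraic-integer coefficients whose
  prime-index coefficients away from `M N ℓ` EQUAL `a_p(W)` — for every `ℓ`.
* `torsionSharingPrimeBound_false_without_new_of_pStabilisedOldform` — K with "`g` in the NEW
  subspace" dropped (Hecke-eigen and `a₁ = 1` kept) is FALSE modulo the existence of one
  `p`-stabilised oldform `f_W(τ) − β f_W(pτ)` (true, printed; kept as a hypothesis): it agrees with
  `W` at every prime `q ≠ p`, so it is congruent to `f_W` modulo EVERY `ℓ`, yet differs at `p ∣ M`.
  Hence each of the three conjuncts of `IsNewform0` (new / eigen / normalised) is load-bearing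
  (the other two: file I).
* `isNewformOf_of_torsionSharingPrimeBound_of_coeff_eq` — modulo the integrality fact
  `IsNewform0.isIntegral_coeff` (Shimura Thm 3.48, named fact of the tree), K implies: a newform `g`
  of ANY level `M` with `a_p(g) = a_p(W)` for all primes `p ∤ M N` is the newform of `W`. That is
  strong multiplicity one + level = conductor for the pair `(f_W, g)` (Atkin–Lehner–Li, Carayol): a
  prover of K must import `IsNewform0.eq_of_heckeEigenvalue_eq`,
  `IsNewform0.level_eq_of_heckeEigenvalue_eq`, `IsNewformOf.level_eq_conductorNorm` or reprove them.

Refuter seat cdisprove-stmt-ABC-2157, 2026-08-16.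
-/

noncomputable section

open scoped MatrixGroups ModularForm
open CongruenceSubgroup
open Literature.NumberTheory.EllipticCurves.ModularForms
open Summit.ABC.ABC.Theses.IsogenyGlueCongruence (TorsionSharingPrimeBound)

set_option linter.dupNamespace false

namespace Summit.ABC.ABC.Theorems.TorsionSharingPrimeBound.Negative

/-! ## The ring of algebraic integers reduces onto a field of any prime characteristic -/

/-- The ring of all algebraic integers of `ℂ`, as a subring. [folklore] -/
def algInt : Subring ℂ := (integralClosure ℤ ℂ).toSubring

/-- Membership in `algInt` is integrality over `ℤ`. [folklore] -/
theorem mem_algInt {x : ℂ} : x ∈ algInt ↔ IsIntegral ℤ x := by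
  simp [algInt, mem_integralClosure_iff]

/-- `algInt` is an integral extension of `ℤ`. [folklore] -/
instance algInt_isIntegral : Algebra.IsIntegral ℤ algInt := by
  refine ⟨fun x ↦ ?_⟩
  have hx : IsIntegral ℤ (x : ℂ) := mem_algInt.mp x.2
  exact (isIntegral_algHom_iff (algInt.subtype.toIntAlgHom) Subtype.val_injective).mp hx

/-- For every prime `ℓ` there are a field `F` of characteristic `ℓ` and a ring map `algInt → F`
(reduction modulo a maximal ideal above `ℓ`; lying over for the integral extension `algInt / ℤ`,
Mathlib `Ideal.exists_ideal_over_maximal_of_isIntegral`). [folklore] -/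
theorem exists_ringHom_algInt_charP {ℓ : ℕ} (hℓ : ℓ.Prime) :
    ∃ (F : Type) (_ : Field F) (_ : CharP F ℓ), Nonempty (algInt →+* F) := by
  classical
  have hp : Prime (ℓ : ℤ) := Nat.prime_iff_prime_int.mp hℓ
  haveI hPp : (Ideal.span {(ℓ : ℤ)}).IsPrime := (Ideal.span_singleton_prime hp.ne_zero).mpr hp
  haveI hP : (Ideal.span {(ℓ : ℤ)}).IsMaximal :=
    Ideal.IsPrime.isMaximal hPp (by simpa [Ideal.span_singleton_eq_bot] using hp.ne_zero)
  have hinj : Function.Injective (algebraMap ℤ algInt) := by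
    intro a b hab
    have := congrArg (fun x : algInt ↦ (x : ℂ)) hab
    simpa using this
  have hker : RingHom.ker (algebraMap ℤ algInt) ≤ Ideal.span {(ℓ : ℤ)} := by
    rw [(RingHom.injective_iff_ker_eq_bot _).mp hinj]; exact bot_le
  obtain ⟨Q, hQmax, hQ⟩ :=
    Ideal.exists_ideal_over_maximal_of_isIntegral (S := algInt) (Ideal.span {(ℓ : ℤ)}) hker
  have hℓQ : (algebraMap ℤ algInt ℓ) ∈ Q := by
    have : (ℓ : ℤ) ∈ Q.comap (algebraMap ℤ algInt) := by
      rw [hQ]; exact Ideal.mem_span_singleton_self _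
    exact this
  have hℓF : ((ℓ : ℕ) : algInt ⧸ Q) = 0 := by
    have := (Ideal.Quotient.eq_zero_iff_mem).mpr hℓQ
    simpa using this
  obtain ⟨p, hpF⟩ := CharP.exists (algInt ⧸ Q)
  have hpl : p = ℓ := by
    have hdvd : p ∣ ℓ := (CharP.cast_eq_zero_iff (algInt ⧸ Q) p ℓ).mp hℓF
    rcases (Nat.dvd_prime hℓ).mp hdvd with h | h
    · exact absurd h (CharP.char_ne_one (algInt ⧸ Q) p)
    · exact h
  subst hpl
  exact ⟨algInt ⧸ Q, Ideal.Quotient.field Q, hpF, ⟨Ideal.Quotient.mk Q⟩⟩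

/-- **Exact agreement of algebraic-integer coefficients instantiates the congruence hypothesis of K,
for every `ℓ`.** If all `aₙ(g)` are algebraic integers and `a_p(g) = a_p(W)` for the primes
`p ∤ M N ℓ`, then the `(R, F, φ)`-hypothesis of the crux holds at `ℓ` with `R = algInt`. [folklore] -/
theorem cruxCongruence_of_isIntegral {W : WeierstrassCurve ℚ} {M : ℕ} [NeZero M]
    {g : CuspForm (Gamma0 M) 2} (hint : ∀ n, IsIntegral ℤ (cuspCoeff g n)) {ℓ : ℕ} (hℓ : ℓ.Prime)
    (heq : ∀ p : ℕ, p.Prime → ¬ (p ∣ M * W.conductorNorm ℤ * ℓ) →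
      cuspCoeff g p = ((W.LFunction p : ℤ) : ℂ)) :
    ∃ (R : Subring ℂ) (F : Type) (_ : Field F) (_ : CharP F ℓ) (φ : R →+* F)
      (hg : ∀ n : ℕ, cuspCoeff g n ∈ R),
      ∀ p : ℕ, p.Prime → ¬ (p ∣ M * W.conductorNorm ℤ * ℓ) →
        φ ⟨cuspCoeff g p, hg p⟩ = ((W.LFunction p : ℤ) : F) := by
  obtain ⟨F, _, _, ⟨φ⟩⟩ := exists_ringHom_algInt_charP hℓ
  refine ⟨algInt, F, ‹_›, ‹_›, φ, fun n ↦ mem_algInt.mpr (hint n), fun q hq hqd ↦ ?_⟩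
  have hx : (⟨cuspCoeff g q, mem_algInt.mpr (hint q)⟩ : algInt) =
      ((W.LFunction q : ℤ) : algInt) := by
    ext
    simp [heq q hq hqd]
  rw [hx, map_intCast]

/-! ## The "new" conjunct of `IsNewform0` is load-bearing -/

/-- **"`g` is NEW" is load-bearing.** K with `IsNewform0 g` weakened to "`g` is a normalised Hecke
eigenform" (membership in the new subspace dropped) is FALSE, modulo the hypothesis `hP` (TRUE,
printed; kept as a hypothesis for relocation): a `p`-STABILISED OLDFORM — some semistable, globally
minimal elliptic `W/ℚ`, a level `M`, a prime `p ∣ M` and `g ∈ S₂(Γ₀(M))`, a normalised Hecke eigenform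
for ALL `T_q` (`U_q` at `q ∣ M`) with algebraic-integer coefficients, `a_q(g) = a_q(W)` for every
prime `q ≠ p`, and `a_p(g) ≠ a_p(W)`. Instance: `M = N p`, `p ∤ N`, `g = f_W(τ) − β f_W(pτ)` with
`α + β = a_p(W)`, `αβ = p`: `T_q g = a_q g` (`q ≠ p`), `U_p g = α g`, `a₁(g) = 1`, `aₙ(g) = aₙ − β a_{n/p}`,
`a_p(g) = α ≠ a_p(W)` since `β ≠ 0` (Diamond–Shurman §5.6–5.8: degeneracy maps `ι_d` and `T_p` on
oldforms; Gouvêa, LNM 1304, II.3). The witness agrees with `W` at all primes `q ≠ p`, hence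
(`cruxCongruence_of_isIntegral`) is congruent to it modulo EVERY `ℓ`, yet is not `f_W`.
[cite: DiamondShurman2005, §5.6–5.8] -/
theorem torsionSharingPrimeBound_false_without_new_of_pStabilisedOldform
    (hP : ∃ (W : WeierstrassCurve ℚ) (_ : W.IsElliptic) (_ : W.IsGloballyMinimal)
      (_ : NeZero (W.conductorNorm ℤ)), W.IsSemistable ℤ ∧
      ∃ (M : ℕ) (_ : NeZero M) (p : ℕ) (g : CuspForm (Gamma0 M) 2), IsHeckeEigenform g ∧
        IsNormalized g ∧ (∀ n, IsIntegral ℤ (cuspCoeff g n)) ∧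
        (∀ q : ℕ, q.Prime → q ≠ p → cuspCoeff g q = ((W.LFunction q : ℤ) : ℂ)) ∧ p ∣ M ∧
        cuspCoeff g p ≠ ((W.LFunction p : ℤ) : ℂ)) :
    ¬ ∃ κ C : ℝ, 0 ≤ κ ∧ ∀ (W : WeierstrassCurve ℚ) [W.IsElliptic] [W.IsGloballyMinimal]
      [NeZero (W.conductorNorm ℤ)], W.IsSemistable ℤ →
      ∀ (M : ℕ) [NeZero M] (g : CuspForm (Gamma0 M) 2), IsHeckeEigenform g → IsNormalized g →
      ¬ IsNewformOf W g → ∀ ℓ : ℕ, ℓ.Prime →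
      ∀ (R : Subring ℂ) (F : Type) [Field F] [CharP F ℓ] (φ : R →+* F)
        (hg : ∀ n : ℕ, cuspCoeff g n ∈ R),
        (∀ p : ℕ, p.Prime → ¬ (p ∣ M * W.conductorNorm ℤ * ℓ) →
          φ ⟨cuspCoeff g p, hg p⟩ = ((W.LFunction p : ℤ) : F)) →
      (ℓ : ℝ) ≤ C * ((M : ℝ) * (W.conductorNorm ℤ : ℝ)) ^ κ := by
  rintro ⟨κ, C, -, h⟩
  obtain ⟨W, _, _, _, hW, M, _, p, g, heig, hnorm, hint, hq, hpM, hp⟩ := hP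
  -- a prime beyond the bound
  obtain ⟨ℓ, hge, hℓ⟩ :=
    Nat.exists_infinite_primes (⌈C * ((M : ℝ) * (W.conductorNorm ℤ : ℝ)) ^ κ⌉₊ + 1)
  have hℓgt : C * ((M : ℝ) * (W.conductorNorm ℤ : ℝ)) ^ κ < ℓ := by
    have h1 : (⌈C * ((M : ℝ) * (W.conductorNorm ℤ : ℝ)) ^ κ⌉₊ : ℝ) + 1 ≤ ℓ := by
      exact_mod_cast hge
    linarith [Nat.le_ceil (C * ((M : ℝ) * (W.conductorNorm ℤ : ℝ)) ^ κ)]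
  have hne : ¬ IsNewformOf W g := fun hgW ↦ hp (hgW.2 p)
  obtain ⟨R, F, _, _, φ, hgR, hc⟩ := cruxCongruence_of_isIntegral (W := W) hint hℓ
    (fun q hq' hqd ↦ hq q hq' (by
      rintro rfl
      exact hqd (dvd_mul_of_dvd_left (dvd_mul_of_dvd_left hpM _) _)))
  have hle := h W hW M g heig hnorm hne ℓ hℓ R F φ hgR hc
  linarith

/-! ## The eigenvalue form of the rigidity K subsumes -/

/-- **K proves strong multiplicity one / level = conductor for the pairs `(f_W, g)`**, modulo the
integrality fact `IsNewform0.isIntegral_coeff` (named fact of the tree, Shimura Thm 3.48): if K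
holds, `W` is semistable (globally minimal, conductor `N`) and `g` is a newform of ANY level `M` with
`a_p(g) = a_p(W)` for all primes `p ∤ M N`, then `IsNewformOf W g` (all `aₙ` agree; with the fact
`IsNewformOf.level_eq_conductorNorm`, `M = N`). Proof: otherwise `g` is an admissible partner
congruent to `W` modulo EVERY prime `ℓ` (`cruxCongruence_of_isIntegral`), contradicting the fixed
bound. So any proof of K contains the Atkin–Lehner–Li / Carayol rigidity for such pairs (named facts
`IsNewform0.eq_of_heckeEigenvalue_eq`, `IsNewform0.level_eq_of_heckeEigenvalue_eq`,
`IsNewform0.heckeEigenvalue_eq_coeff`, `IsNewformOf.level_eq_conductorNorm`). [folklore] -/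
theorem isNewformOf_of_torsionSharingPrimeBound_of_coeff_eq (hK : TorsionSharingPrimeBound)
    {W : WeierstrassCurve ℚ} [W.IsElliptic] [W.IsGloballyMinimal] [NeZero (W.conductorNorm ℤ)]
    (hW : W.IsSemistable ℤ) {M : ℕ} [NeZero M]
    (hint : IsNewform0.isIntegral_coeff (N := M) (k := 2))
    {g : CuspForm (Gamma0 M) 2} (hg : IsNewform0 g)
    (heq : ∀ p : ℕ, p.Prime → ¬ (p ∣ M * W.conductorNorm ℤ) →
      cuspCoeff g p = ((W.LFunction p : ℤ) : ℂ)) :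
    IsNewformOf W g := by
  by_contra hne
  obtain ⟨κ, C, -, h⟩ := hK
  obtain ⟨ℓ, hge, hℓ⟩ :=
    Nat.exists_infinite_primes (⌈C * ((M : ℝ) * (W.conductorNorm ℤ : ℝ)) ^ κ⌉₊ + 1)
  have hℓgt : C * ((M : ℝ) * (W.conductorNorm ℤ : ℝ)) ^ κ < ℓ := by
    have h1 : (⌈C * ((M : ℝ) * (W.conductorNorm ℤ : ℝ)) ^ κ⌉₊ : ℝ) + 1 ≤ ℓ := by
      exact_mod_cast hge
    linarith [Nat.le_ceil (C * ((M : ℝ) * (W.conductorNorm ℤ : ℝ)) ^ κ)]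
  obtain ⟨R, F, _, _, φ, hgR, hc⟩ := cruxCongruence_of_isIntegral (W := W)
    (fun n ↦ hint hg n) hℓ
    (fun p hp hpd ↦ heq p hp (fun hd ↦ hpd (dvd_mul_of_dvd_left hd ℓ)))
  have hle := h W hW M g hg hne ℓ hℓ R F φ hgR hc
  linarith

end Summit.ABC.ABC.Theorems.TorsionSharingPrimeBound.Negative

end
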